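import Literature.MathematicalPhysics.QuantumFieldTheory.CCHS2024.Langevin2D
import Mathlib.LinearAlgebra.Matrix.Kronecker
import HarnessLib

/-!
# Chandra–Chevyrev–Hairer–Shen: the state space `(𝒮, Σ)` and the renormalised stochastic Yang–Mills
# equation in 3D (Invent. Math. 237 (2024), §§1.3–1.4, §2, §5) — pure Yang–Mills case

Cross-ladder literature typing (R141 (D) item (5), third file; venue `CCHS2024/`). STATEMENTS ONLY —
nothing here is a claim about the Yang–Mills mass gap. Source: A. Chandra, I. Chevyrev, M. Hairer,
H. Shen, *Stochastic quantisation of Yang–Mills–Higgs in 3D*, Invent. Math. 237 (2024) 541–696,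
arXiv:2201.03487 (held `paper:arxiv-2201.03487`; bib `ChandraEtAl2024` = `ChandraChevyrevHairerShen2022YMH3`).
**Numbering** (published = shared per-section counter; the held TeX layer prints per-kind counters):
§1 = Rem. 1.1, Thm 1.2 (state space), Rem. 1.3–1.6, Thm 1.7 (local existence), Rem. 1.8, Thm 1.9
(gauge covariance), Rem. 1.10 — reconstructed by counting the numbered environments of §1 in the
held text; section numbers (§2.1 Def. of `Θ`, `ℐ`; §2.3 `Σ`, `𝒮`; §2.4 conditions (𝒢ℐ), (𝒢𝒮);
§2.5 the estimate on gauge transformations; §5 first paragraph, the final parameter regime;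
Thm 5.1) are certain, in-section item numbers of §§2, 5 are cited by name.

## The printed statements (pure Yang–Mills: Higgs target `V = {0}`, `E = 𝔤³`)

* **Theorem 1.2 (state space).** For every `η ∈ (−½ − κ, −½)`, `κ > 0` small, there is a complete
  nonlinear metric space `(𝒮, Σ)` of `E`-valued distributions on `𝕋³` with: (i) `𝒮 ↪ C^η`,
  `C^ν ↪ 𝒮` densely for some `ν < 0`; (ii) the DeTurck–YMH flow extends to `𝒮`,
  `lim_{t→0} Σ(𝓕_t(X), X) = 0`; (iii) `X ∼ Y :⇔ 𝓕̃(X) = 𝓕̃(Y)` extends gauge equivalence and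
  `𝔒 = 𝒮/∼` is separable completely Hausdorff; (iv) for some `ρ ∈ (½,1)` a continuous left action of
  `𝔊^ρ` on `𝒮` with `X ∼ X^g`; (v) there are `ν ∈ (0,½)`, `C, q > 0` with
  `|g|_{C^ν} ≤ C (1 + Σ(X,0) + Σ(X^g,0))^q` for all `g ∈ 𝔊^ρ`, `X ∈ 𝒮` (Thm of §2.5).
* `Σ(X,Y) = Θ(X,Y) + ⦃A − Ā⦄_{α,θ}` (Rem. 1.5, §2.3), `Θ(X,Y) = |X − Y|_{C^η} + ⟦X;Y⟧_{β,δ}`,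
  `⟦X;Y⟧_{β,δ} = sup_{t∈(0,1)} t^δ |𝒩_t X − 𝒩_t Y|_{C^β}`, `𝒩_t X = 𝒫_t X ⊗ ∇𝒫_t X`, `𝒫_t = e^{tΔ}`
  (§2.1); `⦃A⦄_{α,θ} = sup_{t∈(0,1)} |𝒫_t A|_{α-gr;<t^θ}`, `|A|_{α-gr;<t} = sup_{|ℓ|<t} |A(ℓ)|/|ℓ|^α`
  (§2.3); `ℐ`, `𝒮` = closures of the smooth functions under `Θ`, `Σ`; parameter conditions (ℐ),
  (𝒢ℐ), (𝒢𝒮) (§2.1, §2.4) and the final regime of §5 (first paragraph).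
* **Theorem 1.7 (local existence)** for (1.14):
  `∂_t A_i = ΔA_i + [A_j, 2∂_j A_i − ∂_i A_j + [A_j,A_i]] + C^ε_𝔄 A_i + ξ^ε_i`, `A(0) = a ∈ 𝒮`,
  `χ^ε(t,x) = ε⁻⁵χ(ε⁻²t, ε⁻¹x)`: for every mollifier `χ` there exist `(C^ε_YM)_{ε∈(0,1]} ⊂ L_G(𝔤,𝔤)`
  depending only on `χ` such that (i) for every `C̊ ∈ L_G(𝔤,𝔤)` the solutions with
  `C^ε_𝔄 = C^ε_YM + C̊` converge in `𝒮^sol` in probability as `ε → 0`; (ii) the limit depends only on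
  `C̊` and not on `χ`. (Rem. 1.8: `C^ε_YM` is determined by the BPHZ character; unlike `d = 2` it
  diverges.)
* **Theorem 1.9 (gauge covariance)** — quoted, not transcribed (see "Not transcribed").

## What is typed (print → Lean)

* `𝕋³` via the cover `E3` (`intShift3`, `torusDist3`); `𝔤³`-valued fields (`Field3`), their heat flow
  `𝒫_t` (`heatKernel3`, `heatFlow`, `Field3.heat`), derivatives (`pdX3`), `𝒩_t` componentwise as
  Kronecker products (`Field3.quad`); sizes: `supNorm3`, the NEGATIVE-index Hölder–Besov size through
  the heat kernel (`negHolder`, R12), `fancyDist` (`⟦·;·⟧_{β,δ}`), `thetaDist` (`Θ`); 3D segments and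
  line integrals (`Seg3`, `lineIntegral3`), `grNormBelow` (`|·|_{α-gr;<t}`), `heatGr` (`⦃·⦄_{α,θ}`),
  `sigmaDist` (`Σ`); heat data (`HeatDatum`, `heatOf`, `IsHeatFlow`) and the spaces `initSpace3`
  (`ℐ`), `stateSpace3` (`𝒮`) as the `Θ`-closure, resp. `Σ`-closure, of the smooth fields (R13); parameters
  (`StateParams`, `condI`, `condGI`, `condGS`, `printedRegime`, `nearCorner`).
* Gauge transformations on `𝕋³` (`GaugeGroup3`, `gaugeHolder3`, `gaugeCNorm3`, `IsSmoothGauge3`,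
  `gaugeDist3`) and the action on smooth fields `X^g = (Ad_g A_i − (∂_i g)g⁻¹)_i` (`gaugeActField3`).
* 3D mollifiers (`IsSpaceTimeMollifier3`, `IsNonAnticipative3`, `mollScale3`), the mollified white
  noise family (`mollCov3`, `IsMollifiedWhiteNoise3`, `matrixNoise3`), the SYM equation (1.14) as a
  classical PDE (`symDrift3`, `IsClassicalSYMSolution3`, `solLift3`, `IsSYMSolutionPath3`) and the
  blow-up space `𝒮^sol` (`solDist3`, `IsSolPath3`, built on `Σ`).
* Facts: `gaugeBound3D` (Thm 1.2 (v) / §2.5, for smooth `X`, `g` — the dense case, with print's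
  parameter corner), `gaugeActionUniform3D` (Thm 1.2 (iv) / §2.4 Prop.: uniform continuity of the action
  on balls, dense case), `localExistence3D` (Thm 1.7 (i)+(ii), pure YM).

## Renderings (recorded for the reviewer)

* (R1)–(R4), (R7), (R8), (R10) of the sibling files apply verbatim with `𝕋³`, `ℝ × 𝕋³`.
* (R12) Print measures negative regularity by the test-function norm
  `|ξ|_{C^α} = sup_{λ∈(0,1]} sup_{ψ∈𝓑^r} sup_x λ^{−α}|⟨ξ, ψ^λ_x⟩|` (§1.3). Here, for `α < 0`, the heat-kernel
  size `sup_{t∈(0,1)} t^{−α/2} ‖𝒫_t ξ‖_∞` is used instead (`negHolder`); the two are equivalent norms on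
  distributions on `𝕋³` for `α < 0` (print uses this characterisation itself, e.g. the first line of
  the proof of Lemma 2.(heatgr–Besov embedding): "`|A|_{C^η} ≍ sup_t t^{…}|𝒫_t A|_{C^{α−1}}`"). Every
  typed statement (closures, Cauchy/continuity, bounds `≤ C(1 + Σ)^q` with unspecified `C`,
  convergence in probability in `𝒮^sol`) is invariant under replacing `Σ` by an equivalent metric.
* (R13) Elements of `𝒮` are distributions; they are represented by their heat flows
  `h_t = 𝒫_t X` (`t > 0`), which are smooth fields determined by and determining `X`: `HeatDatum`
  with the semigroup consistency `IsHeatFlow`; a smooth field `X` is the datum `t ↦ 𝒫_t X` (`heatOf`);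
  `𝒮` = the `Σ`-closure of `{heatOf X : X smooth}` among consistent heat flows of finite size.
* (R14) Pure Yang–Mills only (`V = {0}`: no Higgs component, no `𝐁`-terms, `C_Φ` absent); print
  treats a general orthogonal representation `V` of `G`. -- TODO(general form): Higgs field.
* (R15) Parameters: print fixes (§5, first paragraph) `η ∈ (−2/3,−½)`, `δ ∈ (¾,1)`,
  `β ∈ (−½, −2(1−δ))`, `θ ∈ (0,1]`, `α ∈ (0,½)` with `β̂ := β + 2(1−δ) ≥ 2θ(α−1)`, `β̂ ≥ η̂ := 1−2δ−η`,
  `β̂ < η + ½`, "and such that the conditions of Theorem [§2.5] hold" (`θ = 0+`, `α = ½−`,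
  `β = −2(1−δ)−`, `η = −½−`, print's "`x = a±`" meaning: for all `x` close enough to `a` on that side).
  Typed as `printedRegime p ∧ nearCorner ε₀ p` under `∃ ε₀ > 0`.

## Not transcribed

Theorem 1.2 (i)–(iii) (embeddings, the DeTurck–YMH flow `𝓕`, the relation `∼` and the topology of
`𝔒`), §2.2 (backwards uniqueness), §§2.6–2.8; Theorem 1.9 / Thm 6.1 (gauge covariance in law:
"there exists a unique `C̊_𝔄 ∈ L_G(𝔤,𝔤)`, independent of the mollifier, with
`g • 𝒜_{C̊}(a) =ˡᵃʷ 𝒜_{C̊}(g(0) • a)` modulo finite-time blow-up, `g` solving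
`g⁻¹∂_t g = ∂_j(g⁻¹∂_j g) + [A_j, g⁻¹∂_j g]`", and the unique Markov process on `𝔒`, Thm of §7) —
these need the evolving rough gauge transformation coupled to the noise as a random distribution;
the open problems of §1.2 (invariant measure ⇒ candidate YMH measure on `𝕋³`; global existence; a
gauge GROUP determining `∼` in 3D) are author-stated OPEN questions, hence not Literature facts
(the global-existence question is filed as a `Summits/…/Theorems` conjecture leaf in this vocabulary).
-/

noncomputable section

open MeasureTheory Filter Topology ProbabilityTheory
open scoped ENNReal NNReal

namespace Literature.MathematicalPhysics.QuantumFieldTheory.CCHS2024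

/-! ### `𝕋³`, fields, heat flow, sizes -/

/-- The universal cover `ℝ³` of `𝕋³ = ℝ³/ℤ³`. [cite: ChandraEtAl2024, §1.3 (𝕋³ = ℝ³/ℤ³ identified with [-½,½)³)] -/
abbrev E3 : Type := EuclideanSpace ℝ (Fin 3)

/-- The lattice vector `n ∈ ℤ³ ⊂ ℝ³`. [folklore] -/
def intShift3 (n : Fin 3 → ℤ) : E3 := (EuclideanSpace.equiv (Fin 3) ℝ).symm fun i => (n i : ℝ)

/-- Geodesic distance on `𝕋³`. [cite: ChandraEtAl2024, §1.3 (geodesic distance |x − y|)] -/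
def torusDist3 (x y : E3) : ℝ := ⨅ n : Fin 3 → ℤ, ‖x - y - intShift3 n‖

/-- A `𝔤³`-valued field on the cover: `X = (A₁, A₂, A₃)`, components matrix-valued (pure YM: `E = 𝔤³`,
R14). [cite: ChandraEtAl2024, §1.3 (E = 𝔤³ ⊕ V; a gauge field A = (A₁,A₂,A₃) : 𝕋³ → 𝔤³)] -/
abbrev Field3 (N : ℕ) : Type := E3 → Fin 3 → Matrix (Fin N) (Fin N) ℂ

section Fields

variable {N : ℕ}

namespace Field3

/-- The field lives on `𝕋³` (periodicity, R1). [cite: ChandraEtAl2024, §1.3 (functions on 𝕋³)] -/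
def IsPeriodic (X : Field3 N) : Prop := ∀ (n : Fin 3 → ℤ) (x : E3) (i : Fin 3), X (x + intShift3 n) i = X x i

/-- Smoothness (entrywise, R2): `X ∈ C^∞(𝕋³, E)`. [cite: ChandraEtAl2024, §1.3 (C^∞(𝕋³, E), the configuration space of smooth pairs)] -/
def IsSmooth (X : Field3 N) : Prop :=
  ∀ (i : Fin 3) (a b : Fin N), ContDiff ℝ (⊤ : ℕ∞) fun x : E3 => X x i a b

/-- The components take values in `V ≤ M_N(ℂ)` (`V = 𝔤`). [cite: ChandraEtAl2024, §1.3 (𝔤-valued 1-forms)] -/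
def ValuedIn (V : Submodule ℝ (Matrix (Fin N) (Fin N) ℂ)) (X : Field3 N) : Prop := ∀ x i, X x i ∈ V

end Field3

/-- The heat kernel `p_t(y) = (4πt)^{-3/2} e^{−|y|²/(4t)}` of `e^{tΔ}` on `ℝ³` (`t > 0`). [cite: ChandraEtAl2024, §2.1 Def. (𝒫_t X ≔ e^{tΔ} X)] -/
def heatKernel3 (t : ℝ) (y : E3) : ℝ := (4 * Real.pi * t) ^ (-(3 : ℝ) / 2) * Real.exp (-(‖y‖ ^ 2) / (4 * t))

/-- `(𝒫_t F)(x) = ∫_{ℝ³} p_t(x − y) F(y) dy` for a bounded (periodic) matrix field — the heat semigroup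
of `𝕋³` lifted to the cover (entrywise integrals, R2). [cite: ChandraEtAl2024, §2.1 Def. (𝒫_t X ≔ e^{tΔ} X)] -/
def heatFlow {n : Type} [Fintype n] [DecidableEq n] (F : E3 → Matrix n n ℂ) (t : ℝ) (x : E3) :
    Matrix n n ℂ :=
  Matrix.of fun a b => ∫ y : E3, (heatKernel3 t (x - y) : ℂ) * F y a b

/-- `𝒫_t X`, componentwise. [cite: ChandraEtAl2024, §2.1 Def. (𝒫 X : t ↦ 𝒫_t X)] -/
def Field3.heat (X : Field3 N) (t : ℝ) : Field3 N := fun x i => heatFlow (fun y => X y i) t x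

/-- The sup size `sup_x |F(x)|` of a matrix field (`frobNorm`, extended, R3). [cite: ChandraEtAl2024, §1.3 (|f|_∞)] -/
def supNorm3 {n : Type} [Fintype n] (F : E3 → Matrix n n ℂ) : ℝ≥0∞ := ⨆ x : E3, ENNReal.ofReal (frobNorm (F x))

/-- **Negative-index Hölder–Besov size through the heat kernel**: for `α < 0`,
`|F|_{C^α} ≍ sup_{t∈(0,1)} t^{−α/2} ‖𝒫_t F‖_∞` (R12; print's definition is by test functions).
[cite: ChandraEtAl2024, §1.3 (C^α(𝕋³,E) for α < 0) and §2.3 (proof of the heat–Besov lemma: |A|_{C^η} ≍ sup_t t^{…}|𝒫_t A|)] -/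
def negHolder {n : Type} [Fintype n] [DecidableEq n] (α : ℝ) (F : E3 → Matrix n n ℂ) : ℝ≥0∞ :=
  ⨆ (t : ℝ) (_ : t ∈ Set.Ioo (0 : ℝ) 1), ENNReal.ofReal (t ^ (-α / 2)) * supNorm3 (heatFlow F t)

/-- `∂_j F(x)` for a matrix field on `ℝ³` (entrywise). [cite: ChandraEtAl2024, §1.3 (∇, ∂_j)] -/
def pdX3 {n : Type} (j : Fin 3) (F : E3 → Matrix n n ℂ) (x : E3) : Matrix n n ℂ :=
  Matrix.of fun a b => deriv (fun s : ℝ => F (x + s • EuclideanSpace.single j (1 : ℝ)) a b) 0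

/-- The components `X_i(x) ⊗ ∂_j X_k(x)` of `X ⊗ ∇X ∈ E ⊗ E³` as Kronecker products (pure YM).
[cite: ChandraEtAl2024, §2.1 Def. (𝒩_t(X) ≔ 𝒫_t X ⊗ ∇𝒫_t X)] -/
def Field3.quad (X : Field3 N) (x : E3) (ijk : Fin 3 × Fin 3 × Fin 3) :
    Matrix (Fin N × Fin N) (Fin N × Fin N) ℂ :=
  Matrix.kroneckerMap (· * ·) (X x ijk.1) (pdX3 ijk.2.1 (fun y => X y ijk.2.2) x)

/-- Heat data `t ↦ h_t` (intended: `h_t = 𝒫_t X`, `t ∈ (0,1]`), representing a distribution on `𝕋³`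
by its heat flow (R13). [cite: ChandraEtAl2024, §2.1 Def. (𝒫 X : (0,1) → C^∞(𝕋³,E))] -/
abbrev HeatDatum (N : ℕ) : Type := ℝ → Field3 N

/-- The heat datum `t ↦ 𝒫_t X` of a (smooth, bounded) field `X`. [cite: ChandraEtAl2024, §2.1 Def. (𝒫 X)] -/
def heatOf (X : Field3 N) : HeatDatum N := fun t => X.heat t

/-- Consistency of heat data: `h_{t+s} = 𝒫_s h_t`, each `h_t` smooth, periodic, `V`-valued (R13).
[cite: ChandraEtAl2024, §2.1 Def. (𝒫_t = e^{tΔ}, a semigroup)] -/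
def IsHeatFlow (V : Submodule ℝ (Matrix (Fin N) (Fin N) ℂ)) (h : HeatDatum N) : Prop :=
  (∀ t, 0 < t → (h t).IsSmooth ∧ (h t).IsPeriodic ∧ (h t).ValuedIn V) ∧
    ∀ s t, 0 < s → 0 < t → h (t + s) = (h t).heat s

/-- `⟦X;Y⟧_{β,δ} = sup_{t∈(0,1)} t^δ |𝒩_t X − 𝒩_t Y|_{C^β}` on heat data (components of `E ⊗ E³` by
supremum, R12). [cite: ChandraEtAl2024, §2.1 Def. (⟦X;Y⟧_{β,δ} ≔ |𝒩(X) − 𝒩(Y)|_{𝓑^{β,δ}}, |Y|_{𝓑^{β,δ}} ≔ sup_t t^δ|Y_t|_{C^β})] -/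
def fancyDist (β δ : ℝ) (h h' : HeatDatum N) : ℝ≥0∞ :=
  ⨆ (t : ℝ) (_ : t ∈ Set.Ioo (0 : ℝ) 1), ENNReal.ofReal (t ^ δ) *
    ⨆ ijk : Fin 3 × Fin 3 × Fin 3, negHolder β fun x => (h t).quad x ijk - (h' t).quad x ijk

/-- `Θ(X,Y) = |X − Y|_{C^η} + ⟦X;Y⟧_{β,δ}` on heat data (`|X − Y|_{C^η}` by its heat characterisation
`sup_t t^{−η/2}‖h_t − h'_t‖_∞`, R12). [cite: ChandraEtAl2024, §2.1 Def. (Θ_{η,β,δ}(X,Y) ≔ |X − Y|_{C^η} + ⟦X;Y⟧_{β,δ})] -/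
def thetaDist (η β δ : ℝ) (h h' : HeatDatum N) : ℝ≥0∞ :=
  (⨆ (t : ℝ) (_ : t ∈ Set.Ioo (0 : ℝ) 1), ENNReal.ofReal (t ^ (-η / 2)) *
      ⨆ i : Fin 3, supNorm3 fun x => h t x i - h' t x i) +
    fancyDist β δ h h'

/-- Oriented line segments of `𝕋³` of length `≤ ¼` (cover representatives). [cite: ChandraEtAl2024, §2.3 (𝒳 = 𝕋³ × B_{1/4})] -/
abbrev Seg3 : Type := {p : E3 × E3 // ‖p.2‖ ≤ (1 : ℝ) / 4}

/-- The line integral `A(x,v) = ∫₀¹ ∑_i v_i A_i(x + tv) dt` of a field along a segment.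
[cite: ChandraEtAl2024, §2.3 (display defining A(x,v) for A ∈ Ω𝓑)] -/
def lineIntegral3 (X : Field3 N) (ℓ : Seg3) : Matrix (Fin N) (Fin N) ℂ :=
  Matrix.of fun a b => ∫ t in (0 : ℝ)..1, ∑ i : Fin 3, X (ℓ.1.1 + t • ℓ.1.2) i a b * ((ℓ.1.2 i : ℝ) : ℂ)

/-- `|A|_{α-gr;<t} = sup_{0 < |ℓ| < t} |A(ℓ)| / |ℓ|^α`. [cite: ChandraEtAl2024, §2.3 Def. (|A|_{α-gr;<t})] -/
def grNormBelow (α t : ℝ) (X : Field3 N) : ℝ≥0∞ :=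
  ⨆ (ℓ : Seg3) (_ : 0 < ‖ℓ.1.2‖) (_ : ‖ℓ.1.2‖ < t),
    ENNReal.ofReal (frobNorm (lineIntegral3 X ℓ) / ‖ℓ.1.2‖ ^ α)

/-- `⦃A⦄_{α,θ} = sup_{t∈(0,1)} |𝒫_t A|_{α-gr;<t^θ}` on heat data. [cite: ChandraEtAl2024, §2.3 Def. (⦃A⦄_{α,θ} ≔ sup_{t∈(0,1)} |𝒫_t A|_{α-gr;<t^θ})] -/
def heatGr (α θ : ℝ) (h : HeatDatum N) : ℝ≥0∞ :=
  ⨆ (t : ℝ) (_ : t ∈ Set.Ioo (0 : ℝ) 1), grNormBelow α (t ^ θ) (h t)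

/-- The parameters `(η, β, δ, α, θ)` of `Σ` and `ρ` of the gauge group. [cite: ChandraEtAl2024, §2.3 (Σ ≡ Σ_{η,β,δ,α,θ}) and §2.4 ((ρ,η,β,δ,α,θ) ∈ ℝ⁶)] -/
structure StateParams where
  /-- `η`: the `C^η` exponent (`η = −½−`). -/
  η : ℝ
  /-- `β`: the `C^β` exponent of `𝒩_t` (`β = −2(1−δ)−`). -/
  β : ℝ
  /-- `δ`: the blow-up weight `t^δ` (`δ ∈ (¾,1)`). -/
  δ : ℝ
  /-- `α`: the growth exponent of line integrals (`α = ½−`). -/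
  α : ℝ
  /-- `θ`: the scale exponent in `|·|_{α-gr;<t^θ}` (`θ = 0+`). -/
  θ : ℝ
  /-- `ρ`: the Hölder exponent of the gauge group `𝔊^ρ` (`ρ ∈ (½,1)`). -/
  ρ : ℝ

/-- **`Σ(X,X̄) = Θ(X,X̄) + ⦃A − Ā⦄_{α,θ}`** on heat data. [cite: ChandraEtAl2024, §2.3 Def. eq. (Σ(X,X̄) ≔ Θ(X,X̄) + ⦃A − Ā⦄_{α,θ}) and Rem. 1.5] -/
def sigmaDist (p : StateParams) (h h' : HeatDatum N) : ℝ≥0∞ :=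
  thetaDist p.η p.β p.δ h h' + heatGr p.α p.θ (h - h')

/-- Condition (ℐ): `η ∈ (−2/3, 0]`, `β ∈ (−1, 0]`, `δ ∈ (0,1)`, `β̂ := β + 2(1−δ) ∈ (−½, 0]`,
`η + β̂ > −1`. [cite: ChandraEtAl2024, §2.1 Def. (condition (ℐ))] -/
def condI (p : StateParams) : Prop :=
  -2 / 3 < p.η ∧ p.η ≤ 0 ∧ -1 < p.β ∧ p.β ≤ 0 ∧ 0 < p.δ ∧ p.δ < 1 ∧
    -1 / 2 < p.β + 2 * (1 - p.δ) ∧ p.β + 2 * (1 - p.δ) ≤ 0 ∧ -1 < p.η + (p.β + 2 * (1 - p.δ))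

/-- Condition (𝒢ℐ): `ρ ∈ [3/2 − δ, 1]`, `η ∈ [2 − 2δ − ρ, ρ − 1]`, `β ∈ (−ρ, 0]`, `δ ∈ [½, 1)`.
[cite: ChandraEtAl2024, §2.4 Def. (condition (𝒢ℐ))] -/
def condGI (p : StateParams) : Prop :=
  3 / 2 - p.δ ≤ p.ρ ∧ p.ρ ≤ 1 ∧ 2 - 2 * p.δ - p.ρ ≤ p.η ∧ p.η ≤ p.ρ - 1 ∧ -p.ρ < p.β ∧ p.β ≤ 0 ∧
    1 / 2 ≤ p.δ ∧ p.δ < 1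

/-- Condition (𝒢𝒮): (𝒢ℐ) and `α ∈ (0,1]`, `θ ≥ 0`, `ρ ≥ 1 + 2θ(α−1)`, `ρ + (1+2θ)(α−1) > 0`.
[cite: ChandraEtAl2024, §2.4 Def. (condition (𝒢𝒮))] -/
def condGS (p : StateParams) : Prop :=
  condGI p ∧ 0 < p.α ∧ p.α ≤ 1 ∧ 0 ≤ p.θ ∧ 1 + 2 * p.θ * (p.α - 1) ≤ p.ρ ∧
    0 < p.ρ + (1 + 2 * p.θ) * (p.α - 1)

/-- The parameter regime fixed for the SPDE (§5, first paragraph, R15): `η ∈ (−2/3,−½)`, `δ ∈ (¾,1)`,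
`β ∈ (−½, −2(1−δ))`, `θ ∈ (0,1]`, `α ∈ (0,½)`, and with `β̂ = β + 2(1−δ)`, `η̂ = 1 − 2δ − η`:
`β̂ ≥ 2θ(α−1)`, `β̂ ≥ η̂`, `β̂ < η + ½`. [cite: ChandraEtAl2024, §5 (first paragraph: "Throughout the rest of the paper, let us fix …")] -/
def printedRegime (p : StateParams) : Prop :=
  -2 / 3 < p.η ∧ p.η < -1 / 2 ∧ 3 / 4 < p.δ ∧ p.δ < 1 ∧ -1 / 2 < p.β ∧ p.β < -2 * (1 - p.δ) ∧
    0 < p.θ ∧ p.θ ≤ 1 ∧ 0 < p.α ∧ p.α < 1 / 2 ∧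
    2 * p.θ * (p.α - 1) ≤ p.β + 2 * (1 - p.δ) ∧ 1 - 2 * p.δ - p.η ≤ p.β + 2 * (1 - p.δ) ∧
    p.β + 2 * (1 - p.δ) < p.η + 1 / 2

/-- "`θ = 0+`, `α = ½−`, `β = −2(1−δ)−`, `η = −½−`" within `ε₀` (R15). [cite: ChandraEtAl2024, §2 (the convention "η = α−, β = ν+") and §2.5 Thm (θ = 0+, α = ½−, δ ∈ (¾,1), β = −2(1−δ)−, η = −½−)] -/
def nearCorner (ε₀ : ℝ) (p : StateParams) : Prop :=
  p.θ < ε₀ ∧ 1 / 2 - ε₀ < p.α ∧ -2 * (1 - p.δ) - ε₀ < p.β ∧ -1 / 2 - ε₀ < p.η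

end Fields

/-! ### Gauge transformations on `𝕋³` and the spaces `ℐ`, `𝒮` -/

section Gauge3

variable {G : Type*} [Group G] [TopologicalSpace G] (r : LatticeRep G)

/-- `g : 𝕋³ → G` as a periodic map on the cover. [cite: ChandraEtAl2024, §1.3 (𝔊^ρ ≔ C^ρ(𝕋³, G))] -/
def IsPeriodicGauge3 (g : E3 → G) : Prop := ∀ (n : Fin 3 → ℤ) (x : E3), g (x + intShift3 n) = g x

/-- The `ρ`-Hölder seminorm of `g : 𝕋³ → G ⊂ M_N(ℂ)`. [cite: ChandraEtAl2024, §1.3 (𝔊^ρ, G understood as embedded into a space of matrices)] -/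
def gaugeHolder3 (ρ : ℝ) (g : E3 → G) : ℝ≥0∞ :=
  ⨆ (x : E3) (y : E3) (_ : 0 < torusDist3 x y),
    ENNReal.ofReal (frobNorm (r.ρ (g x) - r.ρ (g y)) / torusDist3 x y ^ ρ)

/-- `|g|_{C^ν} = |g|_∞ + |g|_{ν-Höl}`. [cite: ChandraEtAl2024, §1.3 (|f|_{C^α} ≔ |f|_∞ + |f|_{α-Höl}) and Thm 1.2 (v)] -/
def gaugeCNorm3 (ν : ℝ) (g : E3 → G) : ℝ≥0∞ :=
  (⨆ x : E3, ENNReal.ofReal (frobNorm (r.ρ (g x)))) + gaugeHolder3 r ν g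

/-- The gauge group `𝔊^ρ = C^ρ(𝕋³, G)`. [cite: ChandraEtAl2024, §1.3 (𝔊^ρ ≔ C^ρ(𝕋³, G))] -/
def GaugeGroup3 (ρ : ℝ) : Set (E3 → G) := {g | IsPeriodicGauge3 g ∧ gaugeHolder3 r ρ g < ∞}

/-- `g ∈ 𝔊^∞ = C^∞(𝕋³, G)` (entries of `ρ ∘ g` smooth). [cite: ChandraEtAl2024, §1 (𝔊^∞ ≔ C^∞(𝕋^d, G))] -/
def IsSmoothGauge3 (g : E3 → G) : Prop := ∀ a b : Fin r.N, ContDiff ℝ (⊤ : ℕ∞) fun x : E3 => r.ρ (g x) a b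

/-- The `C^ρ` distance between gauge transformations (in the ambient matrices). [cite: ChandraEtAl2024, §1.3 (𝔊^ρ with G embedded into matrices)] -/
def gaugeDist3 (ρ : ℝ) (g h : E3 → G) : ℝ≥0∞ :=
  (⨆ x : E3, ENNReal.ofReal (frobNorm (r.ρ (g x) - r.ρ (h x)))) +
    ⨆ (x : E3) (y : E3) (_ : 0 < torusDist3 x y),
      ENNReal.ofReal
        (frobNorm ((r.ρ (g x) - r.ρ (h x)) - (r.ρ (g y) - r.ρ (h y))) / torusDist3 x y ^ ρ)

/-- The gauge action on (smooth) fields: `(X^g)_i = Ad_g A_i − (∂_i g) g⁻¹` (pure YM part of (1.5)).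
[cite: ChandraEtAl2024, §1 eq. (1.5) (A^g ≔ Ad_g(A) − (dg)g⁻¹)] -/
def gaugeActField3 (g : E3 → G) (X : Field3 r.N) : Field3 r.N := fun x i =>
  r.ρ (g x) * X x i * star (r.ρ (g x)) - pdX3 i (fun y => r.ρ (g y)) x * star (r.ρ (g x))

/-- Smooth `𝔤³`-valued fields on `𝕋³` (the configuration space `C^∞(𝕋³, E)`, pure YM).
[cite: ChandraEtAl2024, §1.3 (C^∞(𝕋³, E))] -/
def smoothFields3 : Set (Field3 r.N) := {X | X.IsSmooth ∧ X.IsPeriodic ∧ X.ValuedIn r.lieAlg}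

/-- **`ℐ`**: the closure of the smooth fields under `Θ` (as heat data among consistent heat flows of
finite `Θ`-size, R13). [cite: ChandraEtAl2024, §2.1 Def. (ℐ ≔ closure of smooth functions under Θ)] -/
def initSpace3 (p : StateParams) : Set (HeatDatum r.N) :=
  {h | IsHeatFlow r.lieAlg h ∧ thetaDist p.η p.β p.δ h 0 < ∞ ∧
    ∀ ε : ℝ, 0 < ε → ∃ X ∈ smoothFields3 r, thetaDist p.η p.β p.δ (heatOf X) h < ENNReal.ofReal ε}

/-- **`𝒮`**: the closure of the smooth fields under `Σ` (R13) — the state space of Theorem 1.2.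
[cite: ChandraEtAl2024, §2.3 Def. (𝒮 ≔ closure of smooth functions under Σ) and Thm 1.2] -/
def stateSpace3 (p : StateParams) : Set (HeatDatum r.N) :=
  {h | IsHeatFlow r.lieAlg h ∧ sigmaDist p h 0 < ∞ ∧
    ∀ ε : ℝ, 0 < ε → ∃ X ∈ smoothFields3 r, sigmaDist p (heatOf X) h < ENNReal.ofReal ε}

/-- **Theorem 1.2 (v) / Theorem of §2.5 (estimate on gauge transformations), dense case.** With
`θ = 0+`, `α = ½−`, `δ ∈ (¾,1)`, `β = −2(1−δ)−`, `η = −½−` there is `ν = ½−` such that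
`|g|_{C^ν} ≲_{Σ(X)+Σ(X^g)} 1`, i.e. `|g|_{C^ν} ≤ C (1 + Σ(X,0) + Σ(X^g,0))^q`, typed for smooth `X` and
smooth `g` (print: all `X ∈ ℐ`, `g ∈ 𝔊^{0,ρ}`; Rem. 1.4: "crucial in the construction of the Markov
process"). [cite: ChandraEtAl2024, Thm 1.2 (v) and §2.5 Thm (estimate |g|_{C^ν} ≲_{Σ(X)+Σ(X^g)} 1)] -/
def gaugeBound3D : Prop :=
  ∀ (G : Type) [Group G] [TopologicalSpace G] [CompactSpace G] (r : LatticeRep G) (δ : ℝ),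
    3 / 4 < δ → δ < 1 → ∀ ν₁ : ℝ, ν₁ < 1 / 2 →
    ∃ ε₀ : ℝ, 0 < ε₀ ∧ ∀ p : StateParams, p.δ = δ → printedRegime p → nearCorner ε₀ p →
      ∃ ν : ℝ, ν₁ < ν ∧ ν < 1 / 2 ∧ ∃ C q : ℝ, 0 < C ∧ 0 < q ∧
        ∀ X ∈ smoothFields3 r, ∀ g : E3 → G, IsPeriodicGauge3 g → IsSmoothGauge3 r g →
          sigmaDist p (heatOf X) 0 < ∞ → sigmaDist p (heatOf (gaugeActField3 r g X)) 0 < ∞ →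
          (gaugeCNorm3 r ν g).toReal ≤
            C * (1 + (sigmaDist p (heatOf X) 0).toReal +
              (sigmaDist p (heatOf (gaugeActField3 r g X)) 0).toReal) ^ q

/-- **Theorem 1.2 (iv) / Proposition of §2.4 (the gauge action is uniformly continuous on balls),
dense case.** If `(ρ,η,β,δ,α,θ)` satisfies (𝒢𝒮), `(g, X) ↦ X^g` is a continuous left group action
`𝔊^{0,ρ} × 𝒮 → 𝒮`, uniformly continuous on every ball of `𝔊^{0,ρ} × 𝒮`; typed on the dense subset
of smooth `g`, `X` (from which the action on `𝒮` is obtained by extension).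
[cite: ChandraEtAl2024, Thm 1.2 (iv) and §2.4 Prop. (group action, "uniformly continuous on every ball")] -/
def gaugeActionUniform3D : Prop :=
  ∀ (G : Type) [Group G] [TopologicalSpace G] [CompactSpace G] (r : LatticeRep G) (p : StateParams),
    condGS p → ∀ R ε : ℝ, 0 < R → 0 < ε → ∃ η₁ : ℝ, 0 < η₁ ∧
      ∀ X ∈ smoothFields3 r, ∀ X' ∈ smoothFields3 r, ∀ g g' : E3 → G,
        IsPeriodicGauge3 g → IsSmoothGauge3 r g → IsPeriodicGauge3 g' → IsSmoothGauge3 r g' →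
        sigmaDist p (heatOf X) 0 ≤ ENNReal.ofReal R → sigmaDist p (heatOf X') 0 ≤ ENNReal.ofReal R →
        gaugeCNorm3 r p.ρ g ≤ ENNReal.ofReal R → gaugeCNorm3 r p.ρ g' ≤ ENNReal.ofReal R →
        sigmaDist p (heatOf X) (heatOf X') < ENNReal.ofReal η₁ → gaugeDist3 r p.ρ g g' < ENNReal.ofReal η₁ →
          sigmaDist p (heatOf (gaugeActField3 r g X)) (heatOf (gaugeActField3 r g' X')) <
            ENNReal.ofReal ε

end Gauge3

/-! ### Mollifiers, noise and the SYM equation in 3D -/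

/-- Space-time `ℝ × 𝕋³` through the cover. [cite: ChandraEtAl2024, §1.3 (ℝ × 𝕋³, parabolic distance)] -/
abbrev SpaceTime3 : Type := ℝ × E3

/-- Reflection of the `j`-th spatial coordinate. [cite: ChandraEtAl2024, §1.3 (χ invariant under x_i ↦ −x_i)] -/
def reflectCoord3 (j : Fin 3) (x : E3) : E3 := x - (2 * x j) • EuclideanSpace.single j (1 : ℝ)

/-- A 3D space-time mollifier: compactly supported smooth `χ` on `ℝ × ℝ³` with `∫χ = 1`, even in each
spatial coordinate. [cite: ChandraEtAl2024, §1.3 ("A space-time mollifier χ is a compactly supported smooth function on ℝ × ℝ³ …")] -/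
def IsSpaceTimeMollifier3 (χ : SpaceTime3 → ℝ) : Prop :=
  ContDiff ℝ (⊤ : ℕ∞) χ ∧ HasCompactSupport χ ∧ (∫ z, χ z) = 1 ∧
    ∀ (j : Fin 3) (t : ℝ) (x : E3), χ (t, reflectCoord3 j x) = χ (t, x)

/-- Non-anticipative: supported in `{t ≥ 0}`. [cite: ChandraEtAl2024, §1.3 ("non-anticipative if it is supported in the set {(t,x) : t ≥ 0}")] -/
def IsNonAnticipative3 (χ : SpaceTime3 → ℝ) : Prop := ∀ z : SpaceTime3, z.1 < 0 → χ z = 0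

/-- `χ^ε(t,x) = ε⁻⁵ χ(ε⁻²t, ε⁻¹x)`. [cite: ChandraEtAl2024, §1.4 (χ^ε(t,x) = ε⁻⁵χ(ε⁻²t, ε⁻¹x))] -/
def mollScale3 (χ : SpaceTime3 → ℝ) (ε : ℝ) (z : SpaceTime3) : ℝ := (ε ^ 5)⁻¹ * χ (z.1 / ε ^ 2, ε⁻¹ • z.2)

/-- Covariance of the mollified periodic white noise on `ℝ × 𝕋³` (one scalar component).
[cite: ChandraEtAl2024, §1 eq. (1.4) (E[ξ_i(t,x) ⊗ ξ_j(s,y)] = δ_{ij}δ(t−s)δ(x−y) Cas) and §1.4 (ξ^ε_i ≔ ξ_i * χ^ε)] -/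
def mollCov3 (χ χ' : SpaceTime3 → ℝ) (ε ε' : ℝ) (z w : SpaceTime3) : ℝ :=
  ∑' m : Fin 3 → ℤ, ∫ u : SpaceTime3,
    mollScale3 χ ε (z - u) * mollScale3 χ' ε' (w + ((0 : ℝ), intShift3 m) - u)

/-- Scalar noise components `ζ^{χ,ε}_{i,n}(ω, z)` in 3D (R8). [cite: ChandraEtAl2024, §1.4 (ξ^ε_i ≔ ξ_i * χ^ε)] -/
abbrev NoiseFamily3 (N : ℕ) (Ω : Type*) : Type _ :=
  (SpaceTime3 → ℝ) → ℝ → Ω → SpaceTime3 → Fin 3 → NoiseIdx N → ℝ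

section Noise3

variable {G : Type*} [Group G] [TopologicalSpace G] (r : LatticeRep G)

/-- The `𝔤`-valued mollified noise `ξ^{χ,ε}_i(z) = ∑_n ζ_{i,n}(z) 𝐩(v_n)` (covariance `Cas` of
`(𝔤, Re tr(XY†))`, R7). [cite: ChandraEtAl2024, §1 eq. (1.4) and §1.4] -/
def matrixNoise3 {Ω : Type*} (ζ : NoiseFamily3 r.N Ω) (χ : SpaceTime3 → ℝ) (ε : ℝ) (ω : Ω)
    (z : SpaceTime3) (i : Fin 3) : Matrix (Fin r.N) (Fin r.N) ℂ :=
  ∑ n : NoiseIdx r.N, (ζ χ ε ω z i n : ℂ) • r.lieProj (noiseDir n)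

/-- `ζ` is the family of mollifications of i.i.d. white noises `ξ₁, ξ₂, ξ₃` on `ℝ × 𝕋³` (R8): centred
jointly Gaussian with covariances `δ_{ii'}δ_{nn'} mollCov3`, smooth samples. [cite: ChandraEtAl2024, §1.4 ("Fix i.i.d. 𝔤-valued white noises (ξ_i)_{i=1}^3 on ℝ × 𝕋³ … ξ^ε_i ≔ ξ_i * χ^ε")] -/
def IsMollifiedWhiteNoise3 {Ω : Type*} [MeasurableSpace Ω] (P : Measure Ω) (ζ : NoiseFamily3 r.N Ω) :
    Prop :=
  (∀ (χ : SpaceTime3 → ℝ) (ε : ℝ) (ω : Ω) (i : Fin 3) (n : NoiseIdx r.N), IsSpaceTimeMollifier3 χ →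
      0 < ε → ε ≤ 1 → ContDiff ℝ (⊤ : ℕ∞) fun z : SpaceTime3 => ζ χ ε ω z i n) ∧
  ∀ (k : ℕ) (c : Fin k → ℝ) (χ : Fin k → SpaceTime3 → ℝ) (ε : Fin k → ℝ) (z : Fin k → SpaceTime3)
    (i : Fin k → Fin 3) (n : Fin k → NoiseIdx r.N),
    (∀ j, IsSpaceTimeMollifier3 (χ j) ∧ 0 < ε j ∧ ε j ≤ 1) →
      Measurable (fun ω => ∑ j, c j * ζ (χ j) (ε j) ω (z j) (i j) (n j)) ∧
      P.map (fun ω => ∑ j, c j * ζ (χ j) (ε j) ω (z j) (i j) (n j)) =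
        gaussianReal 0 (Real.toNNReal
          (∑ j, ∑ l, if i j = i l ∧ n j = n l then
            c j * c l * mollCov3 (χ j) (χ l) (ε j) (ε l) (z j) (z l) else 0))

/-- A time-dependent `𝔤³`-valued field `A(t)`. [cite: ChandraEtAl2024, §1.4 eq. (1.14)] -/
abbrev TimeField3 (N : ℕ) : Type := ℝ → Field3 N

/-- `∂_t A_i(t,x)` (entrywise). [cite: ChandraEtAl2024, §1.4 eq. (1.14)] -/
def pdT3 {N : ℕ} (A : TimeField3 N) (t : ℝ) (x : E3) (i : Fin 3) : Matrix (Fin N) (Fin N) ℂ :=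
  Matrix.of fun a b => deriv (fun s : ℝ => A s x i a b) t

/-- `ΔF = ∑_j ∂_j∂_j F`. [cite: ChandraEtAl2024, §1 eq. (1.6) (ΔA_i)] -/
def laplacian3 {N : ℕ} (F : E3 → Matrix (Fin N) (Fin N) ℂ) (x : E3) : Matrix (Fin N) (Fin N) ℂ :=
  ∑ j : Fin 3, pdX3 j (pdX3 j F) x

/-- The nonlinearity `∑_j [A_j, 2∂_j A_i − ∂_i A_j + [A_j, A_i]]` of (1.14) (pure YM: no `𝐁`-term, R14).
[cite: ChandraEtAl2024, §1 eq. (1.7) and §1.4 eq. (1.14)] -/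
def symDrift3 {N : ℕ} (X : Field3 N) (i : Fin 3) (x : E3) : Matrix (Fin N) (Fin N) ℂ :=
  ∑ j : Fin 3, comm (X x j) ((2 : ℂ) • pdX3 j (fun y => X y i) x - pdX3 i (fun y => X y j) x +
    comm (X x j) (X x i))

/-- **Classical solution of the mollified 3D SYM equation (1.14) on `[0,T)`** (pure YM): smooth,
periodic, `𝔤`-valued on `(0,T) × 𝕋³`, `∂_t A_i = ΔA_i + ∑_j[…] + C A_i + ζ_i`, initial condition
`a ∈ 𝒮` in the sense `Σ(𝒫(A(t)), a) → 0` as `t ↓ 0`, and blow-up in `Σ` at `T` if `T < ∞`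
(maximality in `𝒮^sol`). [cite: ChandraEtAl2024, §1.4 eq. (1.14) and Thm 1.7 (with 𝒮^sol of §1.3)] -/
def IsClassicalSYMSolution3 (p : StateParams)
    (C : Matrix (Fin r.N) (Fin r.N) ℂ →ₗ[ℝ] Matrix (Fin r.N) (Fin r.N) ℂ)
    (ζ : SpaceTime3 → Fin 3 → Matrix (Fin r.N) (Fin r.N) ℂ) (a : HeatDatum r.N) (T : ℝ≥0∞)
    (A : TimeField3 r.N) : Prop :=
  0 < T ∧
    (∀ (i : Fin 3) (c d : Fin r.N), ContDiffOn ℝ (⊤ : ℕ∞) (fun q : SpaceTime3 => A q.1 q.2 i c d)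
      {q | 0 < q.1 ∧ ENNReal.ofReal q.1 < T}) ∧
    (∀ t : ℝ, 0 < t → ENNReal.ofReal t < T →
      (A t).IsPeriodic ∧ (A t).ValuedIn r.lieAlg ∧
      ∀ (x : E3) (i : Fin 3),
        pdT3 A t x i = laplacian3 (fun y => A t y i) x + symDrift3 (A t) i x + C (A t x i) + ζ (t, x) i) ∧
    Tendsto (fun t : ℝ => sigmaDist p (heatOf (A t)) a) (𝓝[>] 0) (𝓝 0) ∧
    (T < ∞ → Tendsto (fun t : ℝ => sigmaDist p (heatOf (A t)) 0) (𝓝[<] T.toReal) (𝓝 ∞))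

/-- The `𝒮^sol`-path of a classical solution: `a` at `t ≤ 0`, `𝒫(A(t))` on `(0,T)`, `☠` from `T` on.
[cite: ChandraEtAl2024, §1.3 (F^sol as in [CCHS2d]) and Thm 1.7] -/
def solLift3 {N : ℕ} (a : HeatDatum N) (T : ℝ≥0∞) (A : TimeField3 N) : ℝ → Option (HeatDatum N) :=
  fun t => if t ≤ 0 then some a else if ENNReal.ofReal t < T then some (heatOf (A t)) else none

/-- `f` is the `𝒮^sol`-path of a maximal classical solution of (1.14) with data `(C, ζ, a)`.
[cite: ChandraEtAl2024, Thm 1.7 ("the solution (A,Φ) to the system (1.14)")] -/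
def IsSYMSolutionPath3 (p : StateParams)
    (C : Matrix (Fin r.N) (Fin r.N) ℂ →ₗ[ℝ] Matrix (Fin r.N) (Fin r.N) ℂ)
    (ζ : SpaceTime3 → Fin 3 → Matrix (Fin r.N) (Fin r.N) ℂ) (a : HeatDatum r.N)
    (f : ℝ → Option (HeatDatum r.N)) : Prop :=
  ∃ (T : ℝ≥0∞) (A : TimeField3 r.N), IsClassicalSYMSolution3 r p C ζ a T A ∧ f = solLift3 a T A

end Noise3

/-! ### The blow-up space `𝒮^sol` (metric `D` of [CCHS2d] §1.5.1 with `d = Σ`, `o = 0`) -/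

section BlowUp3

variable {N : ℕ} (p : StateParams)

/-- `h[f] = (1 + Σ(f,0))⁻¹`, `h[☠] = 0`. [cite: ChandraEtAl2024, §1.3 ("we recall the notation F^sol … endowed with a metric as in [CCHS2d]")] -/
def hatH3 : Option (HeatDatum N) → ℝ
  | none => 0
  | some h => (1 + (sigmaDist p h 0).toReal)⁻¹

/-- `d̂(f,g) = d(f,g) ∧ (h[f] + h[g])`, `d = Σ`. [cite: ChandraEtAl2024, §1.3 (F^sol as in [CCHS2d] §1.5.1)] -/
def hatDist3 : Option (HeatDatum N) → Option (HeatDatum N) → ℝ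
  | some h, some h' => min (sigmaDist p h h').toReal (hatH3 p (some h) + hatH3 p (some h'))
  | f, g => hatH3 p f + hatH3 p g

/-- The cone metric `|a − b| + (a ∧ b) d̂(f,g)`. [cite: ChandraEtAl2024, §1.3 (F^sol as in [CCHS2d] §1.5.1)] -/
def coneDist3 (u v : ℝ × Option (HeatDatum N)) : ℝ := |u.1 - v.1| + min u.1 v.1 * hatDist3 p u.2 v.2

/-- `S_f(t) = sup_{s ≤ t} Σ(f(s), 0) ∈ [0,∞]`. [cite: ChandraEtAl2024, §1.3 (F^sol as in [CCHS2d] §1.5.1)] -/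
def runSup3 (f : ℝ → Option (HeatDatum N)) (t : ℝ) : ℝ≥0∞ :=
  ⨆ (s : ℝ) (_ : s ∈ Set.Icc 0 t), match f s with
    | none => ∞
    | some h => sigmaDist p h 0

/-- `Θ_L(f)(t) = (ψ(S_f(t)/L), f(t))`. [cite: ChandraEtAl2024, §1.3 (F^sol as in [CCHS2d] §1.5.1)] -/
def thetaL3 (ψ : ℝ → ℝ) (L : ℕ) (f : ℝ → Option (HeatDatum N)) (t : ℝ) : ℝ × Option (HeatDatum N) :=
  (if runSup3 p f t = ∞ then 0 else ψ ((runSup3 p f t).toReal / L), f t)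

/-- `D_L(f,g) = sup_{t∈[0,L]} d̂(Θ_L(f)(t), Θ_L(g)(t))`. [cite: ChandraEtAl2024, §1.3 (F^sol as in [CCHS2d] §1.5.1)] -/
def distL3 (ψ : ℝ → ℝ) (L : ℕ) (f g : ℝ → Option (HeatDatum N)) : ℝ :=
  ⨆ t : Set.Icc (0 : ℝ) L, coneDist3 p (thetaL3 p ψ L f t) (thetaL3 p ψ L g t)

/-- The metric `D = ∑_{L≥1} 2^{−L} D_L` of `𝒮^sol`. [cite: ChandraEtAl2024, §1.3 (F^sol as in [CCHS2d] §1.5.1)] -/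
def solDist3 (ψ : ℝ → ℝ) (f g : ℝ → Option (HeatDatum N)) : ℝ :=
  ∑' L : ℕ, ((1 : ℝ) / 2) ^ (L + 1) * distL3 p ψ (L + 1) f g

variable {G : Type*} [Group G] [TopologicalSpace G] (r : LatticeRep G)

/-- `f ∈ 𝒮^sol`: `𝒮`-valued and `Σ`-continuous on `[0, T[f])`, `☠` from `T[f] > 0` on, `Σ(f(t),0) → ∞`
as `t ↑ T[f] < ∞`. [cite: ChandraEtAl2024, §1.3 (F^sol: "dynamical systems … which can blow up in finite time and cannot be 'reborn'")] -/
def IsSolPath3 (f : ℝ → Option (HeatDatum r.N)) : Prop :=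
  ∃ T : ℝ≥0∞, 0 < T ∧
    (∀ t : ℝ, 0 ≤ t → (f t = none ↔ T ≤ ENNReal.ofReal t)) ∧
    (∀ t : ℝ, 0 ≤ t → ∀ h, f t = some h → h ∈ stateSpace3 r p) ∧
    (∀ t : ℝ, 0 ≤ t → ∀ h, f t = some h → ∀ ε : ℝ, 0 < ε → ∃ δ : ℝ, 0 < δ ∧
        ∀ s : ℝ, 0 ≤ s → |s - t| < δ → ∀ h', f s = some h' → sigmaDist p h h' < ENNReal.ofReal ε) ∧
    (T < ∞ → ∀ R : ℝ, ∃ δ : ℝ, 0 < δ ∧ ∀ s : ℝ, 0 ≤ s → ENNReal.ofReal s < T →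
        T.toReal - δ < s → ∀ h', f s = some h' → ENNReal.ofReal R < sigmaDist p h' 0)

end BlowUp3

/-! ### Theorem 1.7 (pure Yang–Mills) -/

/-- **Theorem 1.7 (local existence of the renormalised 3D SYM equation; pure Yang–Mills case).**
In the parameter regime of §5 (R15) and for every space-time mollifier there exist mass
renormalisations `(C^{χ,ε}_YM)_{ε∈(0,1]} ⊂ L_G(𝔤,𝔤)` depending only on `χ` such that: (i) for every
`C̊ ∈ L_G(𝔤,𝔤)`, every realisation of the mollified white noises (R8) and every `a ∈ 𝒮`, the
maximal classical solutions of (1.14) with `C^ε_𝔄 = C^{χ,ε}_YM + C̊` driven by `ξ^{χ,ε}` from `a`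
converge in probability in `(𝒮^sol, D)` as `ε → 0` to an `𝒮^sol`-valued random variable; (ii) the
limit depends only on `C̊` and not on `χ`: for two mollifiers (each with its own `C_YM`) and the same
white noise, `C̊` and `a`, the two limits coincide almost surely. (Rem. 1.8: `C^ε_YM` is the BPHZ
renormalisation — divergent as `ε → 0`, unlike `d = 2`; Thm 5.1 is the `σ^ε`-version.)
[cite: ChandraEtAl2024, Thm 1.7 (i)–(ii) with eq. (1.14), Rem. 1.8, §5 (first paragraph) and Thm 5.1] -/
def localExistence3D : Prop :=
  ∀ (G : Type) [Group G] [TopologicalSpace G] [CompactSpace G] (r : LatticeRep G) (δ : ℝ),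
    3 / 4 < δ → δ < 1 →
    ∃ ε₀ : ℝ, 0 < ε₀ ∧ ∀ p : StateParams, p.δ = δ → printedRegime p → nearCorner ε₀ p →
    ∃ CYM : (SpaceTime3 → ℝ) → ℝ → (Matrix (Fin r.N) (Fin r.N) ℂ →ₗ[ℝ] Matrix (Fin r.N) (Fin r.N) ℂ),
      (∀ (χ : SpaceTime3 → ℝ) (ε : ℝ), IsSpaceTimeMollifier3 χ → 0 < ε → ε ≤ 1 →
        CYM χ ε ∈ invariantOps r) ∧
      ∀ (Ω : Type) [MeasurableSpace Ω] (P : Measure Ω) [IsProbabilityMeasure P]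
        (ζ : NoiseFamily3 r.N Ω), IsMollifiedWhiteNoise3 r P ζ →
      ∀ C₀ ∈ invariantOps r, ∀ a ∈ stateSpace3 r p, ∀ (ψ : ℝ → ℝ), IsAdmissibleCutoff ψ →
      ∀ (χ₁ χ₂ : SpaceTime3 → ℝ), IsSpaceTimeMollifier3 χ₁ → IsSpaceTimeMollifier3 χ₂ →
      ∀ (X₁eps X₂eps : ℝ → Ω → ℝ → Option (HeatDatum r.N)),
        (∀ ε : ℝ, 0 < ε → ε ≤ 1 → ∀ᵐ ω ∂P,
          IsSYMSolutionPath3 r p (CYM χ₁ ε + C₀) (matrixNoise3 r ζ χ₁ ε ω) a (X₁eps ε ω) ∧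
          IsSYMSolutionPath3 r p (CYM χ₂ ε + C₀) (matrixNoise3 r ζ χ₂ ε ω) a (X₂eps ε ω)) →
        ∃ X₁ X₂ : Ω → ℝ → Option (HeatDatum r.N),
          (∀ᵐ ω ∂P, IsSolPath3 p r (X₁ ω) ∧ IsSolPath3 p r (X₂ ω)) ∧
          (∀ η₁ : ℝ, 0 < η₁ →
            Tendsto (fun ε : ℝ => P {ω | η₁ < solDist3 p ψ (X₁eps ε ω) (X₁ ω)}) (𝓝[>] 0) (𝓝 0) ∧
            Tendsto (fun ε : ℝ => P {ω | η₁ < solDist3 p ψ (X₂eps ε ω) (X₂ ω)}) (𝓝[>] 0) (𝓝 0)) ∧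
          ∀ᵐ ω ∂P, solDist3 p ψ (X₁ ω) (X₂ ω) = 0

end Literature.MathematicalPhysics.QuantumFieldTheory.CCHS2024
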